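import Mathlib.GroupTheory.Perm.Fin
import Mathlib.GroupTheory.Perm.Cycle.Basic
import Literature.Combinatorics.Sahi2008.Functional
import HarnessLib

/-!
# Lieb–Sahi (2022), Definition 3.1: `E_n` as the signed sum over PERMUTATIONS (cycle form) — equal to the
# tree's `sahiE` for every `n ≥ 1`

Topic `Literature/Combinatorics/Sahi2008` (companion of `Functional.lean`, which DEFINES `sahiE μ n f` by the
Lieb–Sahi recursion [LiebSahi2021, Prop. 3.3], and of `SetPartitionForm.lean`, which proves Sahi's set-partition
definition [Sahi2008, (4)–(7)] equal to it).  This file formalises the THIRD printed presentation, the one Lieb–Sahi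
actually take as the definition, and proves it equal to the tree's functional.

## Source (corpus `paper:arxiv-2107.09838`, p. 7 = J. Math. Phys. 63 (2022), §3.1), verbatim

> "This involves the decomposition of a permutation `σ` in the symmetric group `S_n` as a product of disjoint
> cycles: (13) `σ = (i_1,…,i_p)(j_1,…,j_q)⋯`.  For `σ` as in (13) we write `C_σ` for the number of cycles in `σ`
> and we set (14) `E_σ(f^1,…,f^n) = E(f^{i_1}⋯f^{i_p}) E(f^{j_1}⋯f^{j_q}) ⋯`.  Then the following definition is
> due to Sahi.  **Definition 3.1.** For functions `f^1,…,f^n` on a probability space `X` we define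
> (15) `E_n(f^1,…,f^n) = Σ_{σ ∈ S_n} (−1)^{C_σ − 1} E_σ(f^1,…,f^n)`."
> (p. 7, proof of Prop. 3.3:) "consider the map `σ ↦ σ̄` defined by dropping `n` from the cycle decomposition of
> `σ` … a bijection from each `S^{(i)}` to `S_{n−1}`.  If `σ` is in `S^{(i)}` and `i ≠ n` then `i` and `n` occur in
> the same cycle of `σ` … which implies `Σ^i = e_i`.  If `σ` is in `S^{(n)}` then `(n)` occurs as a separate cycle
> in `σ` and we get `Σ^n = −E_{n−1}(f^1,…,f^{n−1}) E(f^n)`."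

Fixed points count as cycles of length one (so `C_σ` is the number of ORBITS of `σ`, and the identity of `S_n`
contributes `(−1)^{n−1} E(f^1)⋯E(f^n)`).

## What is formalised

* `CycleForm.orbit σ i` (the cycle of `σ` through `i`, as a finite set = a `SameCycle` class), `CycleForm.orbits σ`
  (the set of cycles), `CycleForm.cycleE μ f σ = Π_{c ∈ orbits σ} E(Π_{i∈c} f_i)` = (14), and
  `sahiECycle μ n f = Σ_{σ : Perm (Fin n)} (−1)^{#orbits σ − 1} · cycleE μ f σ` = (15).
* **`sahiE_eq_sahiECycle`**: for every `n ≥ 1`, every finite type, every weight `μ`, every family `f`: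
  `sahiE μ n f = sahiECycle μ n f`.  (At `n = 0` the empty permutation gives `sahiECycle = 1`, the tree's junk
  value is `E_0 = 0`.)
* The proof is Lieb–Sahi's own (p. 7): along Mathlib's `Equiv.Perm.decomposeFin : Perm (Fin (n+1)) ≃ Fin (n+1) ×
  Perm (Fin n)` — which is exactly "`σ ↦ (σ(0), σ̄)`, `σ̄` = `σ` with `0` dropped from its cycle" — the cycles of
  `σ` are those of `σ̄` with `0` inserted into the cycle of `σ(0) − 1` (`orbits_decomposeFin_succ`), or the extra
  one-cycle `(0)` when `σ(0) = 0` (`orbits_decomposeFin_zero`); this gives the recursion of [LiebSahi2021, Prop. 3.3]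
  with the distinguished slot `0` (`sahiECycle_succ_succ`), which is the tree's definition of `sahiE`.

Everything PROVED; no named facts; axioms standard.  Motivation: crux `stmt-CriticalPhenomena-4575` (cell prim-sahi):
with `SetPartitionForm.lean` all three printed definitions of `E_n` (Sahi (7), LS Def. 3.1, LS Prop. 3.3) are now one
tree object.
-/

noncomputable section

namespace Literature.Combinatorics.Sahi2008

open Finset Function Equiv Equiv.Perm

variable {α : Type*} [Fintype α]

namespace CycleForm

/-! ### Cycles of a permutation as finite sets -/

section Orbits

variable {κ : Type*} [Fintype κ] [DecidableEq κ]

/-- The cycle of `σ` through `i` (fixed points are cycles of length one): the `SameCycle` class of `i`.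
[cite: LiebSahi2021, §3.1 eq. (13) (p. 7)] -/
def orbit (σ : Perm κ) (i : κ) : Finset κ :=
  univ.filter fun j => SameCycle σ i j

/-- The set of cycles of `σ` (as the set of their underlying sets). [cite: LiebSahi2021, §3.1 eq. (13) (p. 7)] -/
def orbits (σ : Perm κ) : Finset (Finset κ) :=
  univ.image (orbit σ)

/-- Membership in a cycle (unfolding the cycle decomposition (13)). [cite: LiebSahi2021, §3.1 eq. (13) (p. 7)] -/
@[simp] theorem mem_orbit {σ : Perm κ} {i j : κ} : j ∈ orbit σ i ↔ SameCycle σ i j := by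
  simp [orbit]

/-- `i` lies on its own cycle. [cite: LiebSahi2021, §3.1 eq. (13) (p. 7)] -/
theorem self_mem_orbit (σ : Perm κ) (i : κ) : i ∈ orbit σ i :=
  mem_orbit.2 (SameCycle.refl σ i)

/-- Points on the same cycle have the same cycle (the cycles (13) partition `{1,…,n}`). [cite: LiebSahi2021, §3.1 eq. (13) (p. 7)] -/
theorem orbit_eq_orbit_of_sameCycle {σ : Perm κ} {i j : κ} (h : SameCycle σ i j) : orbit σ i = orbit σ j := by
  ext k
  simp only [mem_orbit]
  exact ⟨fun hk => h.symm.trans hk, fun hk => h.trans hk⟩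

/-- The cycle of `i` is a member of the set of cycles. [cite: LiebSahi2021, §3.1 eq. (13) (p. 7)] -/
theorem orbit_mem_orbits (σ : Perm κ) (i : κ) : orbit σ i ∈ orbits σ :=
  mem_image_of_mem _ (mem_univ i)

omit [DecidableEq κ] in
/-- A `σ`-stable finite set containing `x` contains the whole cycle of `x`. [folklore] -/
private theorem mem_of_sameCycle_of_stable {σ : Perm κ} {S : Finset κ} (hS : ∀ x ∈ S, σ x ∈ S) {x y : κ}
    (hx : x ∈ S) (h : SameCycle σ x y) : y ∈ S := by
  obtain ⟨k, rfl⟩ := h.exists_nat_pow_eq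
  clear h
  induction k with
  | zero => simpa using hx
  | succ k ih =>
    rw [pow_succ', Perm.mul_apply]
    exact hS _ ih

end Orbits

/-! ### `E_σ` and its behaviour under `decomposeFin` ("dropping `0` from its cycle") -/

/-- **`E_σ(f) = Π_{cycles c of σ} E(Π_{i ∈ c} f_i)`** [LiebSahi2021, eq. (14)]. [cite: LiebSahi2021, §3.1 eq. (14) (p. 7)] -/
def cycleE {κ : Type*} [Fintype κ] [DecidableEq κ] (μ : α → ℝ) (f : κ → α → ℝ) (σ : Perm κ) : ℝ :=
  ∏ B ∈ orbits σ, ex μ (fun x => ∏ i ∈ B, f i x)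

section Decompose

variable {n : ℕ}

/-- `decomposeFin.symm (p, τ)` on successors: `(τ x).succ`, swapped with `0` when it hits `p`. [folklore] -/
private theorem decomposeFin_symm_succ_of_ne (p : Fin (n + 1)) (τ : Perm (Fin n)) {x : Fin n} (hx : (τ x).succ ≠ p) :
    decomposeFin.symm (p, τ) x.succ = (τ x).succ := by
  rw [decomposeFin_symm_apply_succ, swap_apply_of_ne_of_ne (Fin.succ_ne_zero _) hx]

/-- When `(τ x).succ = p`, the new permutation sends `x.succ` to `0`. [folklore] -/
private theorem decomposeFin_symm_succ_of_eq (p : Fin (n + 1)) (τ : Perm (Fin n)) {x : Fin n} (hx : (τ x).succ = p) :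
    decomposeFin.symm (p, τ) x.succ = 0 := by
  rw [decomposeFin_symm_apply_succ, hx, swap_apply_right]

/-- Cycles of `σ̄ = τ` lift to cycles of `σ = decomposeFin.symm (p, τ)` on successors ("dropping `n` from the
cycle decomposition", read backwards). [cite: LiebSahi2021, p. 7 (proof of Prop. 3.3)] -/
theorem sameCycle_succ_of_sameCycle (p : Fin (n + 1)) (τ : Perm (Fin n)) {i j : Fin n} (h : SameCycle τ i j) :
    SameCycle (decomposeFin.symm (p, τ)) i.succ j.succ := by
  set σ := decomposeFin.symm (p, τ) with hσ
  obtain ⟨k, rfl⟩ := h.exists_nat_pow_eq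
  clear h
  induction k with
  | zero =>
    rw [pow_zero, Perm.one_apply]
  | succ k ih =>
    rw [pow_succ', Perm.mul_apply]
    set y := (τ ^ k) i with hy
    have h1 : SameCycle σ i.succ (σ y.succ) := sameCycle_apply_right.2 ih
    by_cases hp : (τ y).succ = p
    · -- two steps: `y.succ ↦ 0 ↦ p = (τ y).succ`
      have hσy : σ y.succ = 0 := by rw [hσ]; exact decomposeFin_symm_succ_of_eq p τ hp
      rw [hσy] at h1
      have h2 : SameCycle σ i.succ (σ 0) := sameCycle_apply_right.2 h1
      have hσ0 : σ 0 = (τ y).succ := by rw [hσ, decomposeFin_symm_apply_zero]; exact hp.symm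
      rwa [hσ0] at h2
    · have hσy : σ y.succ = (τ y).succ := by rw [hσ]; exact decomposeFin_symm_succ_of_ne p τ hp
      rwa [hσy] at h1

/-- The successor image of a cycle of `τ` avoiding `p` is stable under `decomposeFin.symm (p, τ)`. [folklore] -/
private theorem sameCycle_succ_imp (p : Fin (n + 1)) (τ : Perm (Fin n)) {i : Fin n}
    (hp : ∀ y, SameCycle τ i y → (τ y).succ ≠ p) {z : Fin (n + 1)}
    (h : SameCycle (decomposeFin.symm (p, τ)) i.succ z) : ∃ j, SameCycle τ i j ∧ z = j.succ := by
  have hmem := mem_of_sameCycle_of_stable (σ := decomposeFin.symm (p, τ))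
    (S := (orbit τ i).map (Fin.succEmb n)) ?_ ?_ h
  · rw [mem_map] at hmem
    obtain ⟨j, hj, rfl⟩ := hmem
    exact ⟨j, mem_orbit.1 hj, rfl⟩
  · intro x hx
    rw [mem_map] at hx ⊢
    obtain ⟨y, hy, rfl⟩ := hx
    refine ⟨τ y, mem_orbit.2 (sameCycle_apply_right.2 (mem_orbit.1 hy)), ?_⟩
    show (τ y).succ = decomposeFin.symm (p, τ) y.succ
    rw [decomposeFin_symm_succ_of_ne p τ (hp y (mem_orbit.1 hy))]
  · exact mem_map.2 ⟨i, self_mem_orbit τ i, rfl⟩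

/-- **`σ(0) = 0`: the cycle of `0` is the one-cycle `(0)`.** [cite: LiebSahi2021, p. 7 (proof of Prop. 3.3, case `σ ∈ S^{(n)}`)] -/
theorem orbit_decomposeFin_zero_zero (τ : Perm (Fin n)) : orbit (decomposeFin.symm (0, τ)) 0 = {0} := by
  ext z
  rw [mem_orbit, mem_singleton]
  constructor
  · intro h
    have := mem_of_sameCycle_of_stable (σ := decomposeFin.symm (0, τ)) (S := ({0} : Finset (Fin (n + 1))))
      (fun x hx => by rw [mem_singleton] at hx ⊢; rw [hx, decomposeFin_symm_apply_zero]) (mem_singleton_self 0) h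
    exact mem_singleton.1 this
  · rintro rfl
    exact SameCycle.refl _ _

/-- `σ(0) = 0`: the other cycles are the successor images of the cycles of `σ̄`. [cite: LiebSahi2021, p. 7 (proof of Prop. 3.3)] -/
theorem orbit_decomposeFin_zero_succ (τ : Perm (Fin n)) (i : Fin n) :
    orbit (decomposeFin.symm (0, τ)) i.succ = (orbit τ i).map (Fin.succEmb n) := by
  ext z
  rw [mem_orbit, mem_map]
  constructor
  · intro h
    obtain ⟨j, hj, rfl⟩ := sameCycle_succ_imp 0 τ (fun y _ => Fin.succ_ne_zero _) h
    exact ⟨j, mem_orbit.2 hj, rfl⟩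
  · rintro ⟨j, hj, rfl⟩
    exact sameCycle_succ_of_sameCycle 0 τ (mem_orbit.1 hj)

/-- The lift of a cycle of `σ̄` to a cycle of `σ` when `σ(0) = e.succ`: insert `0` into the cycle through `e`.
[cite: LiebSahi2021, p. 7 (proof of Prop. 3.3, case `σ ∈ S^{(i)}`, `i ≠ n`)] -/
def liftBlock (e : Fin n) (B : Finset (Fin n)) : Finset (Fin (n + 1)) :=
  if e ∈ B then insert 0 (B.map (Fin.succEmb n)) else B.map (Fin.succEmb n)

/-- `0 ∈ liftBlock e B ↔ e ∈ B`. [folklore] -/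
private theorem zero_mem_liftBlock {e : Fin n} {B : Finset (Fin n)} : (0 : Fin (n + 1)) ∈ liftBlock e B ↔ e ∈ B := by
  unfold liftBlock
  split_ifs with h
  · simp [h]
  · simp only [mem_map, Fin.coe_succEmb, h, iff_false, not_exists, not_and]
    exact fun j _ => Fin.succ_ne_zero j

/-- `(liftBlock e B).erase 0 = B.map succ`. [folklore] -/
private theorem liftBlock_erase_zero (e : Fin n) (B : Finset (Fin n)) :
    (liftBlock e B).erase 0 = B.map (Fin.succEmb n) := by
  have h0 : (0 : Fin (n + 1)) ∉ B.map (Fin.succEmb n) := by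
    simp only [mem_map, Fin.coe_succEmb, not_exists, not_and]
    exact fun j _ => Fin.succ_ne_zero j
  unfold liftBlock
  split_ifs
  · rw [erase_insert h0]
  · rw [erase_eq_of_notMem h0]

/-- `liftBlock e` is injective. [folklore] -/
private theorem liftBlock_injective (e : Fin n) : Function.Injective (liftBlock e) := by
  intro B B' h
  have h1 := liftBlock_erase_zero e B
  rw [h, liftBlock_erase_zero] at h1
  exact (map_injective (Fin.succEmb n)) h1.symm

/-- **`σ(0) = e.succ`: the cycle of `0` is `0` inserted into the cycle of `σ̄` through `e`.**
[cite: LiebSahi2021, p. 7 (proof of Prop. 3.3, case `σ ∈ S^{(i)}`, `i ≠ n`)] -/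
theorem orbit_decomposeFin_succ_zero (τ : Perm (Fin n)) (e : Fin n) :
    orbit (decomposeFin.symm (e.succ, τ)) 0 = insert 0 ((orbit τ e).map (Fin.succEmb n)) := by
  set σ := decomposeFin.symm (e.succ, τ) with hσ
  ext z
  rw [mem_orbit, mem_insert, mem_map]
  constructor
  · intro h
    have hmem := mem_of_sameCycle_of_stable (σ := σ) (S := insert 0 ((orbit τ e).map (Fin.succEmb n))) ?_
      (mem_insert_self _ _) h
    · simpa [mem_insert, mem_map] using hmem
    · intro x hx
      rw [mem_insert, mem_map] at hx
      rcases hx with rfl | ⟨y, hy, rfl⟩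
      · rw [hσ, decomposeFin_symm_apply_zero]
        exact mem_insert_of_mem (mem_map.2 ⟨e, self_mem_orbit τ e, rfl⟩)
      · by_cases hp : (τ y).succ = e.succ
        · rw [Fin.coe_succEmb, hσ, decomposeFin_symm_succ_of_eq _ τ hp]
          exact mem_insert_self _ _
        · rw [Fin.coe_succEmb, hσ, decomposeFin_symm_succ_of_ne _ τ hp]
          exact mem_insert_of_mem (mem_map.2
            ⟨τ y, mem_orbit.2 (sameCycle_apply_right.2 (mem_orbit.1 hy)), rfl⟩)
  · rintro (rfl | ⟨j, hj, rfl⟩)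
    · exact SameCycle.refl _ _
    · have h0 : SameCycle σ 0 e.succ := by
        have := (sameCycle_apply_right (f := σ) (x := (0 : Fin (n + 1))) (y := 0)).2 (SameCycle.refl _ _)
        rwa [hσ, decomposeFin_symm_apply_zero] at this
      exact h0.trans (sameCycle_succ_of_sameCycle _ τ (mem_orbit.1 hj))

/-- `σ(0) = e.succ`: every cycle of `σ` through a successor is the lift of the corresponding cycle of `σ̄`.
[cite: LiebSahi2021, p. 7 (proof of Prop. 3.3)] -/
theorem orbit_decomposeFin_succ_succ (τ : Perm (Fin n)) (e i : Fin n) :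
    orbit (decomposeFin.symm (e.succ, τ)) i.succ = liftBlock e (orbit τ i) := by
  unfold liftBlock
  by_cases hei : e ∈ orbit τ i
  · rw [if_pos hei]
    have hie : SameCycle τ i e := mem_orbit.1 hei
    rw [orbit_eq_orbit_of_sameCycle hie, ← orbit_decomposeFin_succ_zero τ e]
    refine orbit_eq_orbit_of_sameCycle ?_
    -- `i.succ`, `e.succ` and `0` lie on one cycle (`σ 0 = e.succ`)
    have h0 : SameCycle (decomposeFin.symm (e.succ, τ)) 0 e.succ := by
      have := (sameCycle_apply_right (f := decomposeFin.symm (e.succ, τ)) (x := (0 : Fin (n + 1)))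
        (y := 0)).2 (SameCycle.refl _ _)
      rwa [decomposeFin_symm_apply_zero] at this
    exact (h0.trans (sameCycle_succ_of_sameCycle _ τ hie.symm)).symm
  · rw [if_neg hei]
    ext z
    rw [mem_orbit, mem_map]
    constructor
    · intro h
      have hp : ∀ y, SameCycle τ i y → (τ y).succ ≠ e.succ := by
        intro y hy hye
        apply hei
        rw [mem_orbit, ← Fin.succ_inj.1 hye]
        exact sameCycle_apply_right.2 hy
      obtain ⟨j, hj, rfl⟩ := sameCycle_succ_imp e.succ τ hp h
      exact ⟨j, mem_orbit.2 hj, rfl⟩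
    · rintro ⟨j, hj, rfl⟩
      exact sameCycle_succ_of_sameCycle _ τ (mem_orbit.1 hj)

/-- **The cycles of `σ` when `σ(0) = 0`**: the one-cycle `(0)` together with the (shifted) cycles of `σ̄`.
[cite: LiebSahi2021, p. 7 (proof of Prop. 3.3, case `σ ∈ S^{(n)}`)] -/
theorem orbits_decomposeFin_zero (τ : Perm (Fin n)) :
    orbits (decomposeFin.symm (0, τ)) = insert {0} ((orbits τ).image fun B => B.map (Fin.succEmb n)) := by
  unfold orbits
  rw [Fin.univ_succ, cons_eq_insert, image_insert, map_eq_image, image_image, image_image,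
    orbit_decomposeFin_zero_zero]
  congr 1
  exact image_congr fun i _ => orbit_decomposeFin_zero_succ τ i

/-- **The cycles of `σ` when `σ(0) = e.succ`**: the lifts of the cycles of `σ̄` (same number of cycles).
[cite: LiebSahi2021, p. 7 (proof of Prop. 3.3, case `σ ∈ S^{(i)}`, `i ≠ n`)] -/
theorem orbits_decomposeFin_succ (τ : Perm (Fin n)) (e : Fin n) :
    orbits (decomposeFin.symm (e.succ, τ)) = (orbits τ).image (liftBlock e) := by
  unfold orbits
  rw [Fin.univ_succ, cons_eq_insert, image_insert, map_eq_image, image_image, image_image]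
  have h0 : orbit (decomposeFin.symm (e.succ, τ)) 0 = liftBlock e (orbit τ e) := by
    rw [orbit_decomposeFin_succ_zero, liftBlock, if_pos (self_mem_orbit τ e)]
  have himg : univ.image ((orbit (decomposeFin.symm (e.succ, τ))) ∘
      (⇑({ toFun := Fin.succ, inj' := Fin.succ_injective _ } : Fin (n) ↪ Fin (n + 1)))) =
      univ.image (liftBlock e ∘ orbit τ) :=
    image_congr fun i _ => orbit_decomposeFin_succ_succ τ e i
  have hmem : liftBlock e (orbit τ e) ∈ univ.image (liftBlock e ∘ orbit τ) := mem_image.2 ⟨e, mem_univ e, rfl⟩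
  rw [himg, h0, insert_eq_of_mem hmem]

/-- The shifted blocks are not `{0}`. [folklore] -/
private theorem map_succ_ne_singleton_zero (B : Finset (Fin n)) (hB : B.Nonempty) :
    B.map (Fin.succEmb n) ≠ ({0} : Finset (Fin (n + 1))) := by
  intro h
  obtain ⟨j, hj⟩ := hB
  have : (Fin.succEmb n j) ∈ ({0} : Finset (Fin (n + 1))) := h ▸ mem_map_of_mem _ hj
  rw [mem_singleton, Fin.coe_succEmb] at this
  exact Fin.succ_ne_zero j this

/-- Cycles are nonempty. [folklore] -/
private theorem nonempty_of_mem_orbits {κ : Type*} [Fintype κ] [DecidableEq κ] {σ : Perm κ} {B : Finset κ}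
    (hB : B ∈ orbits σ) : B.Nonempty := by
  obtain ⟨i, _, rfl⟩ := mem_image.1 hB
  exact ⟨i, self_mem_orbit σ i⟩

/-- **Number of cycles, `σ(0) = 0`**: `C_σ = C_σ̄ + 1`. [cite: LiebSahi2021, p. 7 (proof of Prop. 3.3)] -/
theorem card_orbits_decomposeFin_zero (τ : Perm (Fin n)) :
    (orbits (decomposeFin.symm (0, τ))).card = (orbits τ).card + 1 := by
  rw [orbits_decomposeFin_zero, card_insert_of_notMem, card_image_of_injective _ (map_injective _)]
  rw [mem_image]
  rintro ⟨B, hB, h⟩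
  exact map_succ_ne_singleton_zero B (nonempty_of_mem_orbits hB) h

/-- **Number of cycles, `σ(0) = e.succ`**: `C_σ = C_σ̄`. [cite: LiebSahi2021, p. 7 (proof of Prop. 3.3)] -/
theorem card_orbits_decomposeFin_succ (τ : Perm (Fin n)) (e : Fin n) :
    (orbits (decomposeFin.symm (e.succ, τ))).card = (orbits τ).card := by
  rw [orbits_decomposeFin_succ, card_image_of_injective _ (liftBlock_injective e)]

/-- **`E_σ`, case `σ(0) = 0`**: `E_σ(F) = E(F_0) · E_σ̄(tail F)`. [cite: LiebSahi2021, p. 7 (proof of Prop. 3.3, `Σ^n = −E_{n−1}(…)E(f^n)`)] -/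
theorem cycleE_decomposeFin_zero (μ : α → ℝ) (F : Fin (n + 1) → α → ℝ) (τ : Perm (Fin n)) :
    cycleE μ F (decomposeFin.symm (0, τ)) = ex μ (F 0) * cycleE μ (Fin.tail F) τ := by
  unfold cycleE
  rw [orbits_decomposeFin_zero, prod_insert, prod_image fun B _ B' _ h => map_injective _ h]
  · congr 1
    · simp
    · refine prod_congr rfl fun B _ => ?_
      congr 1
      funext x
      rw [prod_map]
      rfl
  · rw [mem_image]
    rintro ⟨B, hB, h⟩
    exact map_succ_ne_singleton_zero B (nonempty_of_mem_orbits hB) h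

omit [Fintype α] in
/-- The block integrand after lifting: inserting `0` into the block through `e` multiplies `F_{e+1}` by `F_0`.
[cite: LiebSahi2021, p. 7 (proof of Prop. 3.3, `E_σ = E_σ̄(f^1,…,f^i f^n,…)`)] -/
theorem prod_liftBlock (F : Fin (n + 1) → α → ℝ) (e : Fin n) (B : Finset (Fin n)) (x : α) :
    ∏ i ∈ liftBlock e B, F i x = ∏ j ∈ B, Function.update (Fin.tail F) e (Fin.tail F e * F 0) j x := by
  have h0 : (0 : Fin (n + 1)) ∉ B.map (Fin.succEmb n) := by
    simp only [mem_map, Fin.coe_succEmb, not_exists, not_and]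
    exact fun j _ => Fin.succ_ne_zero j
  unfold liftBlock
  by_cases he : e ∈ B
  · rw [if_pos he, prod_insert h0, prod_map]
    have hL : ∏ j ∈ B, F ((Fin.succEmb n) j) x = F e.succ x * ∏ j ∈ B.erase e, F j.succ x := by
      rw [← mul_prod_erase B (fun j => F ((Fin.succEmb n) j) x) he]
      rfl
    have hR : ∏ j ∈ B, Function.update (Fin.tail F) e (Fin.tail F e * F 0) j x =
        (F e.succ x * F 0 x) * ∏ j ∈ B.erase e, F j.succ x := by
      rw [← mul_prod_erase B (fun j => Function.update (Fin.tail F) e (Fin.tail F e * F 0) j x) he]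
      congr 1
      · rw [Function.update_self]
        rfl
      · exact prod_congr rfl fun j hj => by rw [Function.update_of_ne (ne_of_mem_erase hj)]; rfl
    rw [hL, hR]
    ring
  · rw [if_neg he, prod_map]
    refine prod_congr rfl fun j hj => ?_
    rw [Function.update_of_ne (ne_of_mem_of_not_mem hj he)]
    rfl

/-- **`E_σ`, case `σ(0) = e.succ`**: `E_σ(F) = E_σ̄(tail F with slot e multiplied by F_0)`.
[cite: LiebSahi2021, p. 7 (proof of Prop. 3.3, `Σ^i = e_i`)] -/
theorem cycleE_decomposeFin_succ (μ : α → ℝ) (F : Fin (n + 1) → α → ℝ) (τ : Perm (Fin n)) (e : Fin n) :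
    cycleE μ F (decomposeFin.symm (e.succ, τ)) =
      cycleE μ (Function.update (Fin.tail F) e (Fin.tail F e * F 0)) τ := by
  unfold cycleE
  rw [orbits_decomposeFin_succ, prod_image fun B _ B' _ h => liftBlock_injective e h]
  refine prod_congr rfl fun B _ => ?_
  congr 1
  funext x
  exact prod_liftBlock F e B x

end Decompose

end CycleForm

/-! ### Definition 3.1 and its agreement with the tree's `sahiE` -/

open CycleForm

/-- **Lieb–Sahi's Definition 3.1** (due to Sahi): `E_n(f^1,…,f^n) = Σ_{σ ∈ S_n} (−1)^{C_σ − 1} E_σ(f^1,…,f^n)`,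
`C_σ` = number of cycles (orbits) of `σ`, `E_σ` = product over the cycles of the expectations of the products.
[cite: LiebSahi2021, Def. 3.1 (p. 7)] -/
def sahiECycle (μ : α → ℝ) (n : ℕ) (f : Fin n → α → ℝ) : ℝ :=
  ∑ σ : Perm (Fin n), (-1 : ℝ) ^ ((orbits σ).card - 1) * cycleE μ f σ

/-- `n = 1`: `S_1 = {id}`, one cycle, `E_1(f) = E(f)`. [cite: LiebSahi2021, §3.1 (p. 7, "E_1, E_2, E_3 coincide with their earlier definitions")] -/
theorem sahiECycle_one (μ : α → ℝ) (f : Fin 1 → α → ℝ) : sahiECycle μ 1 f = ex μ (f 0) := by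
  unfold sahiECycle
  rw [Fintype.sum_unique]
  have horb : orbits (default : Perm (Fin 1)) = {{0}} := by
    unfold orbits
    rw [univ_unique, image_singleton]
    congr 1
  simp only [cycleE, horb, prod_singleton, card_singleton, Nat.sub_self, pow_zero, one_mul]

/-- The number of cycles of a permutation of a nonempty finite type is positive. [folklore] -/
private theorem card_orbits_pos {n : ℕ} (τ : Perm (Fin (n + 1))) : 0 < (orbits τ).card :=
  card_pos.2 ⟨_, orbit_mem_orbits τ 0⟩

/-- **The Lieb–Sahi recursion for Definition 3.1** [LiebSahi2021, Prop. 3.3], distinguished slot `0`: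
`E_{n+2}(F) = Σ_e E_{n+1}(tail F with slot e multiplied by F_0) − E_{n+1}(tail F)·E(F_0)` — the sum over `S_{n+2}`
split along `decomposeFin` according to `σ(0)`. [cite: LiebSahi2021, Prop. 3.3 and its proof (p. 7)] -/
theorem sahiECycle_succ_succ (μ : α → ℝ) (n : ℕ) (F : Fin (n + 2) → α → ℝ) :
    sahiECycle μ (n + 2) F =
      (∑ e : Fin (n + 1), sahiECycle μ (n + 1) (Function.update (Fin.tail F) e (Fin.tail F e * F 0))) -
        sahiECycle μ (n + 1) (Fin.tail F) * ex μ (F 0) := by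
  unfold sahiECycle
  rw [← Equiv.sum_comp decomposeFin.symm, Fintype.sum_prod_type, Fin.sum_univ_succ]
  -- `σ(0) = 0`: the extra one-cycle flips the sign and factors out `E(F 0)`
  have h0 : ∑ τ : Perm (Fin (n + 1)), (-1 : ℝ) ^ ((orbits (decomposeFin.symm (0, τ))).card - 1) *
      cycleE μ F (decomposeFin.symm (0, τ)) =
      -(∑ τ : Perm (Fin (n + 1)), (-1 : ℝ) ^ ((orbits τ).card - 1) * cycleE μ (Fin.tail F) τ) * ex μ (F 0) := by
    rw [neg_mul, sum_mul, ← sum_neg_distrib]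
    refine sum_congr rfl fun τ _ => ?_
    rw [card_orbits_decomposeFin_zero, cycleE_decomposeFin_zero, Nat.add_sub_cancel]
    obtain ⟨c, hc⟩ : ∃ c, (orbits τ).card = c + 1 := ⟨(orbits τ).card - 1, (Nat.sub_add_cancel (card_orbits_pos τ)).symm⟩
    rw [hc, Nat.add_sub_cancel, pow_succ]
    ring
  -- `σ(0) = e.succ`: same number of cycles, slot `e` absorbs `F 0`
  have h1 : ∀ e : Fin (n + 1), ∑ τ : Perm (Fin (n + 1)),
      (-1 : ℝ) ^ ((orbits (decomposeFin.symm (e.succ, τ))).card - 1) * cycleE μ F (decomposeFin.symm (e.succ, τ)) =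
      ∑ τ : Perm (Fin (n + 1)), (-1 : ℝ) ^ ((orbits τ).card - 1) *
        cycleE μ (Function.update (Fin.tail F) e (Fin.tail F e * F 0)) τ := by
    intro e
    refine sum_congr rfl fun τ _ => ?_
    rw [card_orbits_decomposeFin_succ, cycleE_decomposeFin_succ]
  rw [h0, sum_congr rfl fun e _ => h1 e]
  ring

/-- **Lieb–Sahi's Definition 3.1 IS the tree's `E_n`**: for every `n ≥ 1`, every weight and every family,
`sahiE μ n f = sahiECycle μ n f` (both satisfy the recursion of [LiebSahi2021, Prop. 3.3] with `E_1 = E`).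
[cite: LiebSahi2021, Def. 3.1 and Prop. 3.3 (p. 7)] -/
theorem sahiE_eq_sahiECycle (μ : α → ℝ) : ∀ (n : ℕ), 1 ≤ n → ∀ f : Fin n → α → ℝ, sahiE μ n f = sahiECycle μ n f
  | 0, h, _ => absurd h (by norm_num)
  | 1, _, f => by rw [sahiE_one_apply, sahiECycle_one]
  | n + 2, _, f => by
    rw [sahiE_succ_succ, sahiECycle_succ_succ]
    congr 1
    · exact sum_congr rfl fun e _ => sahiE_eq_sahiECycle μ (n + 1) (by omega) _
    · rw [sahiE_eq_sahiECycle μ (n + 1) (by omega)]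

/-- At `n = 0` the cycle form gives `1` (the empty permutation has no cycles: `(−1)^{0−1}·(empty product) = 1` with
truncated subtraction), whereas the tree's junk value is `E_0 = 0`. [folklore] -/
example (μ : α → ℝ) (f : Fin 0 → α → ℝ) : sahiECycle μ 0 f = 1 := by
  unfold sahiECycle cycleE orbits
  simp

/-- Sanity check at `n = 3` against the printed closed form `E_3 = 2E(f^1f^2f^3) + … − …` ("the factor of `2` …
comes from the two 3-cycles"). [cite: LiebSahi2021, §3.1 (p. 7, remark after Def. 3.1)] -/
example (μ : α → ℝ) (f g h : α → ℝ) :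
    sahiECycle μ 3 ![f, g, h] = 2 * ex μ (f * g * h) + ex μ f * ex μ g * ex μ h -
      (ex μ f * ex μ (g * h) + ex μ g * ex μ (f * h) + ex μ h * ex μ (f * g)) := by
  rw [← sahiE_eq_sahiECycle μ 3 (by norm_num), sahiE_three]

end Literature.Combinatorics.Sahi2008
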